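import Summits.Parity.BatemanHorn.Theorems.RoughParitySectorsOddSectorShareLinearOneFormShare
import Mathlib.Analysis.PSeries
import HarnessLib

/-!
# Route `RoughParitySectors`, crux `OddSectorShareLinear` (stmt-Parity-15629), line `birth`:
# counting inputs for the prime-background step (`…PrimeBackground*.lean`)

`--supports stmt-Parity-15629` file (line lead, cycle 2). Elementary counting facts about a LINEAR
member `a·X + b` of a Bateman–Horn system (`PrimeBackground.linear_member`: `a ≥ 1`, `eval = a n + b`,
no prime divides both `a` and `b`), used to compare the crux's cells on the background "all other
members prime" with the rough `P_r`-cells of the sieve sequence along that member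
(`Literature.NumberTheory.Sieve.BombieriRoughCells.primeShare_of_floor`):
* `card_filter_eval_lt_le` — small values: `#{n ≤ x : a n + b < z} ≤ z + |b|`;
* `card_filter_dvd_eval_le` — `#{n ≤ x : q ∣ a n + b} ≤ x/q + 1` for `q` coprime to `a`;
* `card_nonSquarefree_rough_le` (= registered sub-goal `stub_nonSquarefreeRoughCount`) — the
  `z`-rough values that are not squarefree are `≤ 2x/z + √M + 1` (`a x + b ≤ M`);
* `pow_cardFactors_le_of_rough`, `cardFactors_le_of_rough` — a `z`-rough value `v` has
  `z^{Ω(v)} ≤ v`, so `Ω(v) ≤ R` once `v < z^{R+1}`.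
No definition, no new fact.
-/

noncomputable section

open Filter Finset Polynomial
open scoped BigOperators Topology
open Literature.NumberTheory.Sieve

namespace Summit.Parity.BatemanHorn.Cruxes.OddSectorShareLinear.Birth

namespace PrimeBackground

/-! ### Linear members of a Bateman–Horn system -/

/-- A member of an all-linear Bateman–Horn system is `a·X + b` with `a ≥ 1`, evaluates as
`a n + b`, and no prime divides both `a` and `b` (no fixed prime divisor). [folklore] -/
theorem linear_member {k : ℕ} {f : Fin k → ℤ[X]} (hf : IsBatemanHornSystem f)
    (hdeg : ∀ i, (f i).natDegree ≤ 1) (i : Fin k) :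
    0 < (f i).coeff 1 ∧ (∀ n : ℕ, (f i).eval (n : ℤ) = (f i).coeff 1 * n + (f i).coeff 0) ∧
      ∀ p : ℕ, p.Prime → (p : ℤ) ∣ (f i).coeff 1 → ¬ (p : ℤ) ∣ (f i).coeff 0 := by
  have hdeg1 : (f i).natDegree = 1 := by have := hf.natDegree_pos i; have := hdeg i; omega
  obtain ⟨hα, hcop, -⟩ :=
    RoughValueLaw.IncrementAnchoring.LinearRoughValueLaw.const_of_linear (f := ![f i])
      (BatemanHornMertens.isBatemanHornSystem_single hf i) hdeg1
  simp only [Matrix.cons_val_zero] at hα hcop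
  refine ⟨hα, fun n => ?_, fun p hp hpa hpb => ?_⟩
  · conv_lhs => rw [eq_X_add_C_of_natDegree_le_one (hdeg i)]
    simp only [eval_add, eval_mul, eval_C, eval_X]
  · -- `p ∣ a`, `p ∣ b` contradicts the coprimality of `(b % a).toNat` and `a.toNat`
    set a : ℤ := (f i).coeff 1
    set b : ℤ := (f i).coeff 0
    have hpa' : p ∣ a.toNat := by
      have : ((a.toNat : ℕ) : ℤ) = a := Int.toNat_of_nonneg hα.le
      exact_mod_cast (show (p : ℤ) ∣ (a.toNat : ℤ) by rw [this]; exact hpa)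
    have hmod : (p : ℤ) ∣ b % a := by
      have e : b % a = b - a * (b / a) := Int.emod_def b a
      rw [e]; exact dvd_sub hpb (dvd_mul_of_dvd_left hpa _)
    have hpb' : p ∣ (b % a).toNat := by
      have h0 : 0 ≤ b % a := Int.emod_nonneg _ hα.ne'
      have : (((b % a).toNat : ℕ) : ℤ) = b % a := Int.toNat_of_nonneg h0
      exact_mod_cast (show (p : ℤ) ∣ ((b % a).toNat : ℤ) by rw [this]; exact hmod)
    have := Nat.Coprime.eq_one_of_dvd (Nat.Coprime.coprime_dvd_left hpb' (hcop.coprime_dvd_right hpa'))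
      (dvd_refl p)
    exact hp.one_lt.ne' this

/-! ### Small values of a member -/

/-- `#{1 ≤ n ≤ x : a n + b < z} ≤ z + |b|` for `a ≥ 1`. [folklore] -/
theorem card_filter_eval_lt_le {a b : ℤ} (ha : 0 < a) (x z : ℕ) :
    ((Finset.Icc 1 x).filter (fun n : ℕ => a * n + b < z)).card ≤ z + b.natAbs := by
  calc ((Finset.Icc 1 x).filter (fun n : ℕ => a * n + b < z)).card
      ≤ (Finset.Icc 1 (z + b.natAbs)).card := by
        refine Finset.card_le_card fun n hn => ?_
        rw [Finset.mem_filter, Finset.mem_Icc] at hn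
        rw [Finset.mem_Icc]
        refine ⟨hn.1.1, ?_⟩
        have h1 : (n : ℤ) ≤ a * n := le_mul_of_one_le_left (by positivity) (by omega)
        have h2 : -(b.natAbs : ℤ) ≤ b := by
          rw [← Int.abs_eq_natAbs]; exact neg_abs_le b
        have : (n : ℤ) < z + b.natAbs := by linarith
        exact_mod_cast this.le
    _ = z + b.natAbs := by simp

/-! ### Residue classes: at most `x/q + 1` solutions of `q ∣ a n + b`, `1 ≤ n ≤ x`, when `(q, a) = 1` -/

/-- If `q ∣ a n + b` has two solutions `n₁ ≤ n₂` then `q ∣ n₂ − n₁` (as `q` is coprime to `a`). [folklore] -/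
theorem dvd_sub_of_dvd_eval {q : ℕ} {a b : ℤ} (hqa : IsCoprime (q : ℤ) a) {n₁ n₂ : ℕ}
    (h₁ : (q : ℤ) ∣ a * n₁ + b) (h₂ : (q : ℤ) ∣ a * n₂ + b) (hle : n₁ ≤ n₂) : q ∣ n₂ - n₁ := by
  have h : (q : ℤ) ∣ a * ((n₂ : ℤ) - n₁) := by
    have := dvd_sub h₂ h₁
    have e : a * n₂ + b - (a * n₁ + b) = a * ((n₂ : ℤ) - n₁) := by ring
    rwa [e] at this
  have h' : (q : ℤ) ∣ (n₂ : ℤ) - n₁ := hqa.dvd_of_dvd_mul_left h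
  have e : ((n₂ - n₁ : ℕ) : ℤ) = (n₂ : ℤ) - n₁ := by push_cast [hle]; ring
  exact_mod_cast (show (q : ℤ) ∣ ((n₂ - n₁ : ℕ) : ℤ) by rw [e]; exact h')

/-- **At most `x/q + 1` solutions**: `#{1 ≤ n ≤ x : q ∣ a n + b} ≤ x/q + 1` for `q ≥ 1` coprime
to `a` (two solutions differ by a multiple of `q`, so `n ↦ (n − 1)/q` is injective on them).
[folklore] -/
theorem card_filter_dvd_eval_le {q : ℕ} (hq : 0 < q) {a b : ℤ} (hqa : IsCoprime (q : ℤ) a) (x : ℕ) :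
    ((Finset.Icc 1 x).filter (fun n : ℕ => (q : ℤ) ∣ a * n + b)).card ≤ x / q + 1 := by
  set S := (Finset.Icc 1 x).filter (fun n : ℕ => (q : ℤ) ∣ a * n + b) with hS
  have hmap : ∀ n ∈ S, (n - 1) / q ∈ Finset.range (x / q + 1) := by
    intro n hn
    rw [hS, Finset.mem_filter, Finset.mem_Icc] at hn
    rw [Finset.mem_range, Nat.lt_succ_iff]
    exact Nat.div_le_div_right (by omega)
  have hinj : Set.InjOn (fun n : ℕ => (n - 1) / q) ↑S := by
    intro n₁ hn₁ n₂ hn₂ heq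
    simp only [hS, Finset.coe_filter, Finset.mem_Icc, Set.mem_setOf_eq] at hn₁ hn₂
    by_contra hne
    rcases Nat.lt_or_gt_of_ne hne with hlt | hlt
    · have hd := dvd_sub_of_dvd_eval hqa hn₁.2 hn₂.2 hlt.le
      have hpos : 0 < n₂ - n₁ := by omega
      have hqle : q ≤ n₂ - n₁ := Nat.le_of_dvd hpos hd
      -- then the quotients differ
      have : (n₁ - 1) / q < (n₂ - 1) / q := by
        have h1 : n₁ - 1 + q ≤ n₂ - 1 := by omega
        calc (n₁ - 1) / q < (n₁ - 1) / q + 1 := Nat.lt_succ_self _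
          _ = (n₁ - 1 + q) / q := by rw [Nat.add_div_right _ hq]
          _ ≤ (n₂ - 1) / q := Nat.div_le_div_right h1
      exact absurd heq this.ne
    · have hd := dvd_sub_of_dvd_eval hqa hn₂.2 hn₁.2 hlt.le
      have hpos : 0 < n₁ - n₂ := by omega
      have hqle : q ≤ n₁ - n₂ := Nat.le_of_dvd hpos hd
      have : (n₂ - 1) / q < (n₁ - 1) / q := by
        have h1 : n₂ - 1 + q ≤ n₁ - 1 := by omega
        calc (n₂ - 1) / q < (n₂ - 1) / q + 1 := Nat.lt_succ_self _
          _ = (n₂ - 1 + q) / q := by rw [Nat.add_div_right _ hq]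
          _ ≤ (n₁ - 1) / q := Nat.div_le_div_right h1
      exact absurd heq.symm this.ne
  calc S.card ≤ (Finset.range (x / q + 1)).card := Finset.card_le_card_of_injOn _ hmap hinj
    _ = x / q + 1 := Finset.card_range _

/-! ### Non-squarefree rough values -/

/-- `∑_{n ∈ [z, P]} 1/n² ≤ 2/z` (Mathlib's `sum_Ioo_inv_sq_le`). [folklore] -/
theorem sum_Icc_inv_sq_le (z P : ℕ) (hz : 1 ≤ z) :
    ∑ n ∈ Finset.Icc z P, ((n : ℝ) ^ 2)⁻¹ ≤ 2 / (z : ℝ) := by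
  have h := sum_Ioo_inv_sq_le (α := ℝ) (z - 1) (P + 1)
  have hsub : Finset.Icc z P ⊆ Finset.Ioo (z - 1) (P + 1) := fun n hn => by
    rw [Finset.mem_Icc] at hn; rw [Finset.mem_Ioo]; omega
  have hz' : ((z - 1 : ℕ) : ℝ) + 1 = z := by
    rw [Nat.cast_sub hz]; push_cast; ring
  rw [hz'] at h
  exact (Finset.sum_le_sum_of_subset_of_nonneg hsub fun n _ _ => by positivity).trans h

/-- **Non-squarefree rough values are few**: for `a ≥ 1` with no prime dividing both `a` and `b`,
`#{1 ≤ n ≤ x : a n + b > 0 is z-rough and not squarefree} ≤ 2x/z + √M + 1` whenever `a x + b ≤ M`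
(`z ≥ 1`): such a value is divisible by `p²` for a prime `z ≤ p ≤ √M`, and each `p` accounts for at
most `x/p² + 1` values of `n`. [folklore] -/
theorem card_nonSquarefree_rough_le {a b : ℤ} (ha : 0 < a)
    (hab : ∀ p : ℕ, p.Prime → (p : ℤ) ∣ a → ¬ (p : ℤ) ∣ b) (x : ℕ) {z : ℕ} (hz : 1 ≤ z) {M : ℕ}
    (hM : a * x + b ≤ M) :
    ((((Finset.Icc 1 x).filter (fun n : ℕ => 0 < a * n + b ∧ (∀ p ∈ Finset.range z, p.Prime →
      ¬ ((p : ℤ) ∣ a * n + b)) ∧ ¬ Squarefree (a * n + b).toNat)).card : ℕ) : ℝ)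
      ≤ 2 * x / z + Nat.sqrt M + 1 := by
  classical
  set S := (Finset.Icc 1 x).filter (fun n : ℕ => 0 < a * n + b ∧ (∀ p ∈ Finset.range z, p.Prime →
      ¬ ((p : ℤ) ∣ a * n + b)) ∧ ¬ Squarefree (a * n + b).toNat) with hS
  set Pr := (Finset.Icc z (Nat.sqrt M)).filter Nat.Prime with hPr
  set T : ℕ → Finset ℕ := fun p => (Finset.Icc 1 x).filter (fun n : ℕ => ((p ^ 2 : ℕ) : ℤ) ∣ a * n + b)
    with hT
  -- `S ⊆ ⋃_{p ∈ Pr} T p`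
  have hsub : S ⊆ Pr.biUnion T := by
    intro n hn
    rw [hS, Finset.mem_filter, Finset.mem_Icc] at hn
    obtain ⟨⟨hn1, hnx⟩, hpos, hrough, hnsq⟩ := hn
    set v : ℕ := (a * n + b).toNat with hv
    have hv0 : (v : ℤ) = a * n + b := Int.toNat_of_nonneg hpos.le
    have hv1 : v ≠ 0 := by
      intro h; rw [h] at hv0; simp at hv0; linarith
    obtain ⟨p, hp, hpv⟩ : ∃ p : ℕ, p.Prime ∧ p * p ∣ v := by
      by_contra h
      push Not at h
      exact hnsq (Nat.squarefree_iff_prime_squarefree.mpr h)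
    rw [Finset.mem_biUnion]
    refine ⟨p, ?_, ?_⟩
    · rw [hPr, Finset.mem_filter, Finset.mem_Icc]
      refine ⟨⟨?_, ?_⟩, hp⟩
      · -- `p ≥ z`: otherwise `p < z` would divide the rough value
        by_contra hlt
        have hpz : p ∈ Finset.range z := Finset.mem_range.mpr (not_le.mp hlt)
        have hpd : (p : ℤ) ∣ a * n + b := by
          rw [← hv0]; exact_mod_cast (dvd_trans (dvd_mul_right p p) hpv)
        exact hrough p hpz hp hpd
      · -- `p ≤ √M` since `p² ≤ v ≤ M`
        rw [Nat.le_sqrt]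
        have hvM : v ≤ M := by
          have : (v : ℤ) ≤ M := by rw [hv0]; exact (by nlinarith [hnx] : a * n + b ≤ a * x + b).trans hM
          exact_mod_cast this
        exact (Nat.le_of_dvd (Nat.pos_of_ne_zero hv1) hpv).trans hvM
    · rw [hT, Finset.mem_filter, Finset.mem_Icc]
      refine ⟨⟨hn1, hnx⟩, ?_⟩
      rw [← hv0, pow_two]
      exact_mod_cast hpv
  -- each `T p`, `p` prime, has at most `x/p² + 1` elements
  have hTp : ∀ p ∈ Pr, ((T p).card : ℝ) ≤ x / (p : ℝ) ^ 2 + 1 := by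
    intro p hp
    have hpp : p.Prime := (Finset.mem_filter.mp hp).2
    have hp0 : 0 < p := hpp.pos
    by_cases hpa : (p : ℤ) ∣ a
    · -- no solutions at all: `p ∣ a`, `p² ∣ a n + b` would give `p ∣ b`
      have : T p = ∅ := by
        rw [hT, Finset.filter_eq_empty_iff]
        intro n _ hdiv
        have h1 : (p : ℤ) ∣ a * n + b := dvd_trans (by exact_mod_cast dvd_pow_self p two_ne_zero) hdiv
        have h2 : (p : ℤ) ∣ b := by
          have := dvd_sub h1 (dvd_mul_of_dvd_left hpa (n : ℤ))
          rwa [add_sub_cancel_left] at this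
        exact hab p hpp hpa h2
      have h0 : ((T p).card : ℝ) = 0 := by rw [this, Finset.card_empty, Nat.cast_zero]
      rw [h0]
      positivity
    · have hcop : IsCoprime (((p ^ 2 : ℕ) : ℤ)) a := by
        have hpa' : ¬ p ∣ a.natAbs := fun h => hpa (Int.natCast_dvd.mpr h)
        have hg : Int.gcd (p : ℤ) a = 1 := by
          have e : Int.gcd (p : ℤ) a = Nat.gcd p a.natAbs := by simp [Int.gcd]
          rw [e]
          exact (Nat.Prime.coprime_iff_not_dvd hpp).mpr hpa'
        have h1 : IsCoprime (p : ℤ) a := Int.isCoprime_iff_gcd_eq_one.mpr hg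
        have := h1.pow_left (m := 2)
        exact_mod_cast this
      have h := card_filter_dvd_eval_le (pow_pos hp0 2) hcop x (b := b)
      have h' : ((T p).card : ℝ) ≤ ((x / p ^ 2 + 1 : ℕ) : ℝ) := by exact_mod_cast h
      have h'' : ((x / p ^ 2 : ℕ) : ℝ) ≤ (x : ℝ) / (p : ℝ) ^ 2 := by
        rw [← Nat.cast_pow]; exact Nat.cast_div_le
      refine h'.trans ?_
      push_cast
      linarith
  -- sum up
  calc ((S.card : ℕ) : ℝ) ≤ ((Pr.biUnion T).card : ℝ) := by exact_mod_cast Finset.card_le_card hsub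
    _ ≤ ∑ p ∈ Pr, ((T p).card : ℝ) := by exact_mod_cast Finset.card_biUnion_le
    _ ≤ ∑ p ∈ Pr, (x / (p : ℝ) ^ 2 + 1) := Finset.sum_le_sum hTp
    _ = x * ∑ p ∈ Pr, ((p : ℝ) ^ 2)⁻¹ + Pr.card := by
        simp only [Finset.sum_add_distrib, Finset.sum_const, nsmul_eq_mul, mul_one, Finset.mul_sum,
          div_eq_mul_inv]
    _ ≤ x * (2 / z) + (Nat.sqrt M + 1) := by
        gcongr
        · calc ∑ p ∈ Pr, ((p : ℝ) ^ 2)⁻¹ ≤ ∑ p ∈ Finset.Icc z (Nat.sqrt M), ((p : ℝ) ^ 2)⁻¹ :=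
                Finset.sum_le_sum_of_subset_of_nonneg (Finset.filter_subset _ _) fun _ _ _ => by positivity
            _ ≤ 2 / z := sum_Icc_inv_sq_le z _ hz
        · calc (Pr.card : ℝ) ≤ ((Finset.Icc z (Nat.sqrt M)).card : ℝ) := by
                exact_mod_cast Finset.card_le_card (Finset.filter_subset _ _)
            _ = ((Nat.sqrt M + 1 - z : ℕ) : ℝ) := by rw [Nat.card_Icc]
            _ ≤ Nat.sqrt M + 1 := by
                have : Nat.sqrt M + 1 - z ≤ Nat.sqrt M + 1 := Nat.sub_le _ _
                exact_mod_cast this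
    _ = 2 * x / z + Nat.sqrt M + 1 := by ring

/-! ### Rough values have few prime factors -/

/-- A `z`-rough positive integer `v` (no prime factor `< z`, `z ≥ 1`) satisfies `z ^ Ω(v) ≤ v`. [folklore] -/
theorem pow_cardFactors_le_of_rough {v z : ℕ} (hv : v ≠ 0)
    (hrough : ∀ p : ℕ, p.Prime → p ∣ v → z ≤ p) : z ^ ArithmeticFunction.cardFactors v ≤ v := by
  rw [ArithmeticFunction.cardFactors_apply]
  calc z ^ v.primeFactorsList.length ≤ v.primeFactorsList.prod :=
        List.pow_card_le_prod v.primeFactorsList z fun p hp =>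
          hrough p (Nat.prime_of_mem_primeFactorsList hp) (Nat.dvd_of_mem_primeFactorsList hp)
    _ = v := Nat.prod_primeFactorsList hv

/-- Hence `Ω(v) ≤ R` as soon as `z ^ (R + 1) > v` (`z ≥ 1`). [folklore] -/
theorem cardFactors_le_of_rough {v z R : ℕ} (hv : v ≠ 0) (hz : 1 ≤ z)
    (hrough : ∀ p : ℕ, p.Prime → p ∣ v → z ≤ p) (hR : v < z ^ (R + 1)) :
    ArithmeticFunction.cardFactors v ≤ R := by
  by_contra h
  have hle : z ^ (R + 1) ≤ z ^ ArithmeticFunction.cardFactors v :=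
    Nat.pow_le_pow_right hz (by omega)
  exact absurd (hle.trans (pow_cardFactors_le_of_rough hv hrough)) (not_le.mpr hR)

end PrimeBackground

/-- **Sub-goal (counting input of the prime-background step)**, registered on crux stmt-Parity-15629 as
`stub_nonSquarefreeRoughCount`, verbatim: for a linear member `a·X + b` (`a ≥ 1`, no prime dividing
both `a` and `b`), the `z`-rough values `a n + b > 0`, `1 ≤ n ≤ x`, that are NOT squarefree number at
most `2x/z + √M + 1` when `a x + b ≤ M` (`PrimeBackground.card_nonSquarefree_rough_le`). [folklore] -/
theorem stub_nonSquarefreeRoughCount :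
    ∀ (a b : ℤ), 0 < a → (∀ p : ℕ, p.Prime → (p : ℤ) ∣ a → ¬ (p : ℤ) ∣ b) → ∀ (x z : ℕ), 1 ≤ z →
    ∀ (M : ℕ), a * x + b ≤ M → ((((Finset.Icc 1 x).filter (fun n : ℕ => 0 < a * n + b ∧ (∀ p ∈
    Finset.range z, p.Prime → ¬ ((p : ℤ) ∣ a * n + b)) ∧ ¬ Squarefree (a * n + b).toNat)).card : ℕ)
    : ℝ) ≤ 2 * x / z + Nat.sqrt M + 1 :=
  fun _ _ ha hab x _ hz _ hM => PrimeBackground.card_nonSquarefree_rough_le ha hab x hz hM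

end Summit.Parity.BatemanHorn.Cruxes.OddSectorShareLinear.Birth

end
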